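import Mathlib
import Summits.MatrixMultiplication.MatrixMultiplication.Theorems.SnSubsetDichotomyHyperoctahedralThresholdInvolutiveTwin
import Summits.MatrixMultiplication.MatrixMultiplication.Theorems.SnSubsetDichotomyHyperoctahedralThresholdReflectionSupply

/-!
# `SnSubsetDichotomy.HyperoctahedralThreshold` — near-symmetric hosts satisfy the open core

Helper file for crux `stmt-MatrixMultiplication-10883` (line `refutation-local-symmetry`, open core
`stub_poorRigidCore`; siege seat k25, variation "supply/tip dichotomy").

Setting as in the companion `…InvolutiveTwin` file: three fixed-point-free involutions `μ c` of `Fin n`, words acting on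
the right, trajectories `x_t := x · z.take t`.  The open core asks, for every large host and every forbidden set `R` with
`|R| ≤ n^{3/4}`, for ONE clean closed rung walk of length `≤ n^{1/4}` avoiding `R`.  In the supply/tip (= supply /
local-hit) dichotomy of crux NOTES §§9, 15 the SUPPLY side is landed (`stub_reflectionSupply`, `stub_twinSupply`,
`stub_sameColourSupply*`); the TIP side says that frequent local hits force local structure, whose exact (rate-one)
instances are colour symmetries.  This file settles the structured endpoint that is provable outright:

* `nearInvolution_cleanWalk` (partial form) / `nearSymmetry_cleanWalk` (global form) — if `θ : Fin n → Fin n` is ANY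
  map and `F` contains `R`, `θ⁻¹R` and every point where `θ` fails to be a fixed-point-free involution commuting with
  the colours (global form: `θ` a fixed-point-free involution of `Fin n`,
  `F ⊇ R ∪ θ⁻¹R ∪ {v : ∃ c, θ (μ c v) ≠ μ c (θ v)}`), and `F` satisfies the counting hypothesis of the `F`-avoiding reflection
  supply (`ReflectionSupply.stub_reflectionSupply`, siege seat k15: `n(n-1) + 2^L(2L+2)|F| < 2^L n`, e.g. `2^L ≥ 2n`
  and `(2L+2)|F| ≤ n/2`), there is clean core-format data with `2 ≤ k+1 ≤ 4L+2` rungs avoiding `R`.  Proof: cyclically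
  reduce the `F`-avoiding collision keeping the trajectory outside `F` (`NearSymmetry.cyclic_of_collision_avoiding`) to
  a closed walk `(x, z)`; along it `θ` commutes with the colours, so `θ x` is a fixed point with trajectory `θ x_t`
  (`NearSymmetry.take_foldl_theta`), and `(x, θ x)` is an involutive twin (`involutiveTwin_cleanWalk`): `x_t ≠ θ x_t`, equal
  self-patterns, symmetric cross-pattern — all because `θ` is a fixed-point-free involution.  No poorness, rigidity,
  expansion or automorphism hypothesis enters; commutation defects on `O(n / log n)` points are tolerated.
* `nearSymmetry_core` — the asymptotic form in the exact quantifier shape of `stub_poorRigidCore`, poor/rigid replaced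
  by "a fixed-point-free involution commuting with the colours off `≤ n^{3/4}` points": `∃ n₀ ∀ n ≥ n₀ …` clean data
  with `k + 1 ≤ n^{1/4}` avoiding any `|R| ≤ n^{3/4}` (`n₀ = 2^40`; the only analysis is `48j + 96 ≤ 2^j` and `rpow`
  bookkeeping: `s = 2^{⌊log₂ n / 4⌋}` has `s⁴ ≤ n`, `12 log₂ n + 48 ≤ s`).

Consequences for the crux (crux NOTES §3 "cyclic covers", §10 T1–T3, §14.3): hosts with a fixed-point-free involutive
colour automorphism (2-covers; even-order semiregular colour automorphism groups via `θ^{m/2}`), and more generally with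
an involutive near-automorphism defective on `O(n^{3/4})` points, are discharged for the one-gadget-with-`R` form WITHOUT
the expander inputs of T3; what remains of the tip/local-hit side is the genuinely approximate regime (constant-rate
local monodromy with no involutive near-symmetry).  Registered forms: `stub_nearSymmetryWalk`, `stub_nearSymmetryCore`
(verbatim wrappers).  Pure finite combinatorics plus `Real.rpow` bookkeeping. [folklore]
-/

-- the project's summit namespace `Summit.MatrixMultiplication.MatrixMultiplication` repeats a component by design (D-0022)

set_option linter.dupNamespace false

namespace Summit.MatrixMultiplication.MatrixMultiplication.Theorems.HyperoctahedralThreshold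

open Equiv

namespace NearSymmetry

variable {n : ℕ}

/-! ### Near-symmetries: a map `θ` commuting with the colours along a trajectory transports it -/

/-- If `θ` commutes with every colour at every trajectory point of `w` from `x`, then the trajectory of `w` from
`θ x` is the `θ`-image of the trajectory from `x` (endpoint form). [folklore] -/
theorem foldl_theta (μ : Fin 3 → Perm (Fin n)) (θ : Fin n → Fin n) (F : Finset (Fin n))
    (hF : ∀ v, v ∉ F → ∀ c, θ (μ c v) = μ c (θ v)) :
    ∀ (w : List (Fin 3)) (x : Fin n), (∀ i : ℕ, (w.take i).foldl (fun v c => μ c v) x ∉ F) →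
      w.foldl (fun v c => μ c v) (θ x) = θ (w.foldl (fun v c => μ c v) x) := by
  intro w
  induction w with
  | nil => intro x _; rfl
  | cons c w ih =>
    intro x hx
    have h0 : x ∉ F := by simpa using hx 0
    rw [List.foldl_cons, List.foldl_cons, ← hF x h0 c]
    refine ih (μ c x) ?_
    intro i
    have h := hx (i + 1)
    rwa [List.take_succ_cons, List.foldl_cons] at h

/-- Trajectory form of `foldl_theta`: every trajectory point of `w` from `θ x` is `θ` of the corresponding
trajectory point from `x`. [folklore] -/
theorem take_foldl_theta (μ : Fin 3 → Perm (Fin n)) (θ : Fin n → Fin n) (F : Finset (Fin n))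
    (hF : ∀ v, v ∉ F → ∀ c, θ (μ c v) = μ c (θ v)) (w : List (Fin 3)) (x : Fin n)
    (hx : ∀ i : ℕ, (w.take i).foldl (fun v c => μ c v) x ∉ F) (i : ℕ) :
    (w.take i).foldl (fun v c => μ c v) (θ x) = θ ((w.take i).foldl (fun v c => μ c v) x) := by
  refine foldl_theta μ θ F hF (w.take i) x ?_
  intro j
  rw [List.take_take]
  exact hx _

end NearSymmetry

open NearSymmetry in
/-- **Short cyclically reduced closed walks avoiding a forbidden set.**  For three fixed-point-free involutions `μ c` of
`Fin n` and a set `F` with `n(n-1) + 2^L(2L+2)|F| < 2^L n` (e.g. `2^L ≥ 2n`, `(2L+2)|F| ≤ n/2`) there is a based closed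
walk `(x, z)`, `z` nonempty and cyclically reduced with `2 ≤ |z| ≤ 4L + 2`, `x · z = x`, ALL of whose trajectory points lie
outside `F`: the `F`-avoiding collision of two distinct involution words at a vertex (`ReflectionSupply.stub_reflectionSupply`,
siege seat k15) reduced by `NearSymmetry.cyclic_of_collision_avoiding`.  This is the vertex-level `R`-avoiding supply
(crux NOTES §2 (S-avoid) made pointwise) on which every structure-side lemma of this file runs. [folklore] -/
theorem closedWalk_avoiding (n L : ℕ) (μ : Fin 3 → Equiv.Perm (Fin n)) (hμ : ∀ c, μ c * μ c = 1)
    (hfpf : ∀ c v, μ c v ≠ v) (F : Finset (Fin n))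
    (hcount : n * (n - 1) + 2 ^ L * ((2 * L + 2) * F.card) < 2 ^ L * n) :
    ∃ (x : Fin n) (z : List (Fin 3)), z ≠ [] ∧ List.IsChain (· ≠ ·) (z ++ z) ∧ 2 ≤ z.length ∧
      z.length ≤ 4 * L + 2 ∧ z.foldl (fun v c => μ c v) x = x ∧
      ∀ i : ℕ, (z.take i).foldl (fun v c => μ c v) x ∉ F := by
  classical
  -- the `F`-avoiding collision of two involution words (siege seat k15)
  obtain ⟨v, w, w', c, c', hneq, hwL, hw'L, hcw, hcw', hcoll, hRw, hRw'⟩ :=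
    ReflectionSupply.stub_reflectionSupply n L μ F hμ hfpf hcount
  set t : List (Fin 3) := w ++ c :: w.reverse with ht_def
  set t' : List (Fin 3) := w' ++ c' :: w'.reverse with ht'_def
  have htt : t ≠ t' := by
    intro h
    obtain ⟨h1, h2⟩ := List.append_inj h (by rw [hwL, hw'L])
    have h3 : c = c' := (List.cons.inj h2).1
    rcases hneq with h4 | h4
    · exact h4 h1
    · exact h4 h3
  have htlen : t.length + t'.length = 4 * L + 2 := by
    simp only [ht_def, ht'_def, List.length_append, List.length_cons, List.length_reverse, hwL, hw'L]
    omega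
  -- involution words are reduced
  have hinvw : ∀ (w : List (Fin 3)) (c : Fin 3), List.IsChain (· ≠ ·) (w ++ [c]) →
      List.IsChain (· ≠ ·) (w ++ c :: w.reverse) := by
    intro w c h
    have hw : List.IsChain (· ≠ ·) w := h.left_of_append
    have hwr : List.IsChain (· ≠ ·) w.reverse :=
      List.isChain_reverse.2 (hw.imp fun a b h => fun h' => h h'.symm)
    have hlast : ∀ x ∈ w.getLast?, x ≠ c := by
      intro x hx
      exact (List.isChain_append.1 h).2.2 x hx c (by simp)
    rw [show w ++ c :: w.reverse = (w ++ [c]) ++ w.reverse by simp]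
    refine List.isChain_append.2 ⟨h, hwr, ?_⟩
    intro x hx y hy
    rw [List.getLast?_concat, Option.mem_def, Option.some.injEq] at hx
    rw [List.head?_reverse] at hy
    subst hx
    exact fun hxy => hlast y hy hxy.symm
  -- cyclic reduction, keeping the trajectory outside `F`
  obtain ⟨u, z, hz0, hzc, hzl, hzfix, hzF⟩ :=
    cyclic_of_collision_avoiding μ hμ hfpf F (t.length + t'.length) t t' v le_rfl htt
      (hinvw w c hcw) (hinvw w' c' hcw') hcoll hRw hRw'
  have hz2 : 2 ≤ z.length := by
    by_contra hlt
    have hl1 : z.length = 1 := by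
      have := List.length_pos_of_ne_nil hz0
      omega
    obtain ⟨a, ha⟩ := List.length_eq_one_iff.1 hl1
    subst ha
    simp at hzc
  exact ⟨_, z, hz0, hzc, hz2, by omega, hzfix, hzF⟩

open NearSymmetry in
/-- **Near-symmetric hosts have a short clean closed rung walk avoiding `R`** (finite form, PARTIAL symmetry).
Let `μ c` be three fixed-point-free involutions of `Fin n` and `θ : Fin n → Fin n` ANY map; let `F` contain every point
at which `θ` is not a fixed-point-free involution commuting with the colours, together with `R` and `θ⁻¹R` (so
outside `F`: `θ (θ v) = v`, `θ v ≠ v`, `v ∉ R`, `θ v ∉ R`, and `θ (μ c v) = μ c (θ v)` for all `c`).  If `n(n-1) + 2^L (2L+2)|F| < 2^L n` (e.g. `2^L ≥ 2n` and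
`(2L+2)|F| ≤ n/2`), there is clean closed-rung-walk data in the output format of the line's core with between `2` and
`4L + 2` rungs, all points outside `R`.  Proof: take the `F`-avoiding closed walk `(x, z)`, `2 ≤ |z| ≤ 4L+2`, of
`closedWalk_avoiding`; along it `θ` commutes with
the colours, so `t ↦ θ x_t` is the trajectory of the fixed point `θ x` (`take_foldl_theta`), and the pair `(x, θ x)` is
an involutive twin (`involutiveTwin_cleanWalk`: `x_t ≠ θ x_t`, equal self-patterns, symmetric cross-pattern — all
because `θ` is a fixed-point-free involution AT THE TRAJECTORY POINTS).  No poorness, rigidity, expansion or automorphism hypothesis is used: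
this settles the "(near-)automorphism trap of order 2" regime of the open core (crux NOTES §10 T3, §14.3) outright,
with commutation defects allowed on `|D| = O(n / log n)` points. [folklore] -/
theorem nearInvolution_cleanWalk (n L : ℕ) (μ : Fin 3 → Equiv.Perm (Fin n)) (hμ : ∀ c, μ c * μ c = 1)
    (hfpf : ∀ c v, μ c v ≠ v) (θ : Fin n → Fin n) (R F : Finset (Fin n))
    (hF : ∀ v, v ∉ F → θ (θ v) = v ∧ θ v ≠ v ∧ v ∉ R ∧ θ v ∉ R ∧ ∀ c, θ (μ c v) = μ c (θ v))
    (hcount : n * (n - 1) + 2 ^ L * ((2 * L + 2) * F.card) < 2 ^ L * n) :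
    ∃ (k : ℕ) (p q : Fin (k + 1) → Fin n) (col : Fin (k + 1) → Fin 3), (∀ i, p i ≠ q i) ∧
      (∀ i, (μ (col i) (p i) = p (i + 1) ∧ μ (col i) (q i) = q (i + 1)) ∨
        (μ (col i) (p i) = q (i + 1) ∧ μ (col i) (q i) = p (i + 1))) ∧
      (∀ i, col i ≠ col (i + 1)) ∧
      (∀ i j, (p i = p j ∧ q i = q j) ∨ (p i = q j ∧ q i = p j) ∨
        (p i ≠ p j ∧ p i ≠ q j ∧ q i ≠ p j ∧ q i ≠ q j)) ∧
      (∀ i, p i ∉ R ∧ q i ∉ R) ∧ 2 ≤ k + 1 ∧ k + 1 ≤ 4 * L + 2 := by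
  classical
  obtain ⟨x, z, _, hzc, hz2, hzle, hzfix, hzF⟩ := closedWalk_avoiding n L μ hμ hfpf F hcount
  have hFc : ∀ v, v ∉ F → ∀ c, θ (μ c v) = μ c (θ v) := fun v hv => (hF v hv).2.2.2.2
  -- pointwise facts at the (good) trajectory points
  have hgood : ∀ i : ℕ, θ (θ ((z.take i).foldl (fun v c => μ c v) x)) = (z.take i).foldl (fun v c => μ c v) x ∧
      θ ((z.take i).foldl (fun v c => μ c v) x) ≠ (z.take i).foldl (fun v c => μ c v) x ∧
      (z.take i).foldl (fun v c => μ c v) x ∉ R ∧ θ ((z.take i).foldl (fun v c => μ c v) x) ∉ R :=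
    fun i => ⟨(hF _ (hzF i)).1, (hF _ (hzF i)).2.1, (hF _ (hzF i)).2.2.1, (hF _ (hzF i)).2.2.2.1⟩
  -- the twin trajectory `t ↦ θ x_t`
  have htraj : ∀ i : ℕ, (z.take i).foldl (fun v c => μ c v) (θ x) = θ ((z.take i).foldl (fun v c => μ c v) x) :=
    fun i => take_foldl_theta μ θ F hFc z x hzF i
  have hfy : z.foldl (fun v c => μ c v) (θ x) = θ x := by
    rw [foldl_theta μ θ F hFc z x hzF, hzfix]
  obtain ⟨k, p, q, col, h1, h2, h3, h4, h5, hk⟩ := involutiveTwin_cleanWalk n μ R z x (θ x) hz2 hzc hzfix hfy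
    (fun s => by rw [htraj]; exact (hgood s).2.1.symm)
    (fun s s' => by
      rw [htraj, htraj]
      exact ⟨fun h => by rw [h], fun h => by rw [← (hgood s).1, ← (hgood s').1, h]⟩)
    (fun s s' => by
      rw [htraj, htraj]
      exact ⟨fun h => by rw [h, (hgood s').1], fun h => by rw [← h, (hgood s).1]⟩)
    (fun s => (hgood s).2.2.1)
    (fun s => by rw [htraj]; exact (hgood s).2.2.2)
  exact ⟨k, p, q, col, h1, h2, h3, h4, h5, by omega, by omega⟩

/-- **Near-symmetric hosts have a short clean closed rung walk avoiding `R`** — the form with a global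
fixed-point-free involution `θ : Equiv.Perm (Fin n)` (only `R`, `θ⁻¹R` and the commutation defects need to be forbidden);
immediate from `nearInvolution_cleanWalk`. [folklore] -/
theorem nearSymmetry_cleanWalk (n L : ℕ) (μ : Fin 3 → Equiv.Perm (Fin n)) (hμ : ∀ c, μ c * μ c = 1)
    (hfpf : ∀ c v, μ c v ≠ v) (θ : Equiv.Perm (Fin n)) (hθ2 : ∀ v, θ (θ v) = v) (hθf : ∀ v, θ v ≠ v)
    (R F : Finset (Fin n)) (hF : ∀ v, v ∉ F → v ∉ R ∧ θ v ∉ R ∧ ∀ c, θ (μ c v) = μ c (θ v))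
    (hcount : n * (n - 1) + 2 ^ L * ((2 * L + 2) * F.card) < 2 ^ L * n) :
    ∃ (k : ℕ) (p q : Fin (k + 1) → Fin n) (col : Fin (k + 1) → Fin 3), (∀ i, p i ≠ q i) ∧
      (∀ i, (μ (col i) (p i) = p (i + 1) ∧ μ (col i) (q i) = q (i + 1)) ∨
        (μ (col i) (p i) = q (i + 1) ∧ μ (col i) (q i) = p (i + 1))) ∧
      (∀ i, col i ≠ col (i + 1)) ∧
      (∀ i j, (p i = p j ∧ q i = q j) ∨ (p i = q j ∧ q i = p j) ∨
        (p i ≠ p j ∧ p i ≠ q j ∧ q i ≠ p j ∧ q i ≠ q j)) ∧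
      (∀ i, p i ∉ R ∧ q i ∉ R) ∧ 2 ≤ k + 1 ∧ k + 1 ≤ 4 * L + 2 :=
  nearInvolution_cleanWalk n L μ hμ hfpf θ R F (fun v hv => ⟨hθ2 v, hθf v, hF v hv⟩) hcount


namespace NearSymmetry

/-- `48 j + 96 ≤ 2 ^ j` for `j ≥ 10` (the only growth estimate the asymptotic form needs). [folklore] -/
theorem lin_le_two_pow : ∀ j : ℕ, 10 ≤ j → 48 * j + 96 ≤ 2 ^ j := by
  intro j hj
  induction j, hj using Nat.le_induction with
  | base => norm_num
  | succ j hj ih =>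
    have h10 : 2 ^ 10 ≤ 2 ^ j := Nat.pow_le_pow_right (by norm_num) hj
    have h2 : 2 ^ (j + 1) = 2 ^ j * 2 := pow_succ 2 j
    rw [h2]
    have : (1024 : ℕ) ≤ 2 ^ j := by simpa using h10
    omega

end NearSymmetry

open NearSymmetry in
/-- **The near-symmetry regime of the open core, asymptotic form** (same quantifier shape as the registered
`stub_poorRigidCore`, with the poorness/rigidity hypotheses replaced by a near-symmetry): for all large `n`, three
fixed-point-free involutions `μ` of `Fin n`, ANY fixed-point-free involution `θ` of `Fin n` commuting with the three
colours at all but `≤ n^{3/4}` points, and any forbidden set `R` with `|R| ≤ n^{3/4}` admit clean closed-rung-walk data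
with at most `n^{1/4}` rungs avoiding `R`.  Bookkeeping: `k₀ = ⌊log₂ n⌋ ≥ 40`, `L = k₀ + 2` (so `2^L ≥ 2n`),
`s = 2^{⌊k₀/4⌋}` (so `s⁴ ≤ n`, `s ≤ n^{1/4}`, and `12k₀ + 48 ≤ s` by `lin_le_two_pow`); the forbidden set of the finite form
is `F = R ∪ θ⁻¹R ∪ D`, `|F|·s ≤ 3n`, whence `(2L+2)|F| ≤ n/2` and the counting hypothesis of `nearSymmetry_cleanWalk`;
its `≤ 4L+2 ≤ s ≤ n^{1/4}` rungs give the bound. [folklore] -/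
theorem nearSymmetry_core : ∃ n₀ : ℕ, ∀ n ≥ n₀, ∀ μ : Fin 3 → Equiv.Perm (Fin n), (∀ i, μ i * μ i = 1 ∧ ∀ v, μ i v ≠ v) → ∀ θ : Equiv.Perm (Fin n), (∀ v, θ (θ v) = v) → (∀ v, θ v ≠ v) → (((Finset.univ : Finset (Fin n)).filter (fun v => ∃ i, θ (μ i v) ≠ μ i (θ v))).card : ℝ) ≤ (n : ℝ) ^ ((3 : ℝ) / 4) → ∀ R : Finset (Fin n), (R.card : ℝ) ≤ (n : ℝ) ^ ((3 : ℝ) / 4) → ∃ (k : ℕ) (p q : Fin (k + 1) → Fin n) (col : Fin (k + 1) → Fin 3), (∀ i, p i ≠ q i) ∧ (∀ i, (μ (col i) (p i) = p (i + 1) ∧ μ (col i) (q i) = q (i + 1)) ∨ (μ (col i) (p i) = q (i + 1) ∧ μ (col i) (q i) = p (i + 1))) ∧ (∀ i, col i ≠ col (i + 1)) ∧ (∀ i j, (p i = p j ∧ q i = q j) ∨ (p i = q j ∧ q i = p j) ∨ (p i ≠ p j ∧ p i ≠ q j ∧ q i ≠ p j ∧ q i ≠ q j)) ∧ (∀ i,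 p i ∉ R ∧ q i ∉ R) ∧ ((k : ℝ) + 1) ≤ (n : ℝ) ^ ((1 : ℝ) / 4) := by
  classical
  refine ⟨2 ^ 40, fun n hn μ hμ θ hθ2 hθf hD R hR => ?_⟩
  -- scales: `k₀ = ⌊log₂ n⌋`, `j = ⌊k₀ / 4⌋`, `s = 2 ^ j`
  have hn1 : 1 ≤ n := le_trans Nat.one_le_two_pow hn
  have hn0 : n ≠ 0 := by omega
  obtain ⟨k₀, hk₀⟩ : ∃ k₀, k₀ = Nat.log 2 n := ⟨_, rfl⟩
  have hk40 : 40 ≤ k₀ := by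
    rw [hk₀]
    exact Nat.le_log_of_pow_le (by norm_num) hn
  obtain ⟨j, hj⟩ : ∃ j, j = k₀ / 4 := ⟨_, rfl⟩
  have hj10 : 10 ≤ j := by omega
  have hj4 : 4 * j ≤ k₀ := by omega
  have hjk : k₀ < 4 * j + 4 := by omega
  obtain ⟨s, hs⟩ : ∃ s, s = 2 ^ j := ⟨_, rfl⟩
  have hs1 : 12 * k₀ + 48 ≤ s := by
    have h := lin_le_two_pow j hj10
    rw [← hs] at h
    omega
  have hs4 : s ^ 4 ≤ n := by
    calc s ^ 4 = 2 ^ (4 * j) := by rw [hs, ← pow_mul, mul_comm]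
      _ ≤ 2 ^ k₀ := Nat.pow_le_pow_right (by norm_num) hj4
      _ ≤ n := by rw [hk₀]; exact Nat.pow_log_le_self 2 hn0
  -- real-number facts
  have hnpos : (0 : ℝ) < n := by exact_mod_cast hn1
  have hsR : (s : ℝ) ≤ (n : ℝ) ^ ((1 : ℝ) / 4) := by
    have h1 : ((s : ℝ) ^ 4) ^ ((1 : ℝ) / 4) = s := by
      rw [show (1 : ℝ) / 4 = ((4 : ℕ) : ℝ)⁻¹ by norm_num]
      exact Real.pow_rpow_inv_natCast (by positivity) (by norm_num)
    have h2 : ((s : ℝ) ^ 4) ≤ (n : ℝ) := by exact_mod_cast hs4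
    calc (s : ℝ) = ((s : ℝ) ^ 4) ^ ((1 : ℝ) / 4) := h1.symm
      _ ≤ (n : ℝ) ^ ((1 : ℝ) / 4) := Real.rpow_le_rpow (by positivity) h2 (by norm_num)
  have hprod : (n : ℝ) ^ ((3 : ℝ) / 4) * (n : ℝ) ^ ((1 : ℝ) / 4) = n := by
    rw [← Real.rpow_add hnpos]
    norm_num
  have hcardR : ∀ A : Finset (Fin n), (A.card : ℝ) ≤ (n : ℝ) ^ ((3 : ℝ) / 4) → A.card * s ≤ n := by
    intro A hA
    have h : (A.card : ℝ) * s ≤ n := by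
      calc (A.card : ℝ) * s ≤ (n : ℝ) ^ ((3 : ℝ) / 4) * (n : ℝ) ^ ((1 : ℝ) / 4) :=
            mul_le_mul hA hsR (by positivity) (by positivity)
        _ = n := hprod
    exact_mod_cast h
  -- the forbidden set `F = R ∪ θ⁻¹ R ∪ D`
  set D : Finset (Fin n) := (Finset.univ : Finset (Fin n)).filter (fun v => ∃ i, θ (μ i v) ≠ μ i (θ v))
    with hD_def
  set Rθ : Finset (Fin n) := (Finset.univ : Finset (Fin n)).filter (fun v => θ v ∈ R) with hRθ_def
  set F : Finset (Fin n) :=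
    (Finset.univ : Finset (Fin n)).filter (fun v => v ∈ R ∨ θ v ∈ R ∨ ∃ i, θ (μ i v) ≠ μ i (θ v)) with hF_def
  have hRθ : Rθ.card ≤ R.card := by
    refine Finset.card_le_card_of_injOn (fun v => θ v) (fun v hv => ?_) (fun a _ b _ h => θ.injective h)
    have hv' : θ v ∈ R := by simpa [hRθ_def] using hv
    simpa using hv'
  have hFsub : F ⊆ R ∪ Rθ ∪ D := by
    intro v hv
    simp only [hF_def, Finset.mem_filter, Finset.mem_univ, true_and] at hv
    simp only [Finset.mem_union, hRθ_def, hD_def, Finset.mem_filter, Finset.mem_univ, true_and]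
    tauto
  have hFcard : F.card ≤ R.card + R.card + D.card := by
    calc F.card ≤ (R ∪ Rθ ∪ D).card := Finset.card_le_card hFsub
      _ ≤ (R ∪ Rθ).card + D.card := Finset.card_union_le _ _
      _ ≤ R.card + Rθ.card + D.card := by
          have := Finset.card_union_le R Rθ
          omega
      _ ≤ R.card + R.card + D.card := by omega
  have hFs : F.card * s ≤ 3 * n := by
    have h1 := hcardR R hR
    have h2 := hcardR D hD
    calc F.card * s ≤ (R.card + R.card + D.card) * s := Nat.mul_le_mul_right _ hFcard
      _ = R.card * s + R.card * s + D.card * s := by ring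
      _ ≤ n + n + n := by omega
      _ = 3 * n := by ring
  have hF : ∀ v, v ∉ F → v ∉ R ∧ θ v ∉ R ∧ ∀ c, θ (μ c v) = μ c (θ v) := by
    intro v hv
    simp only [hF_def, Finset.mem_filter, Finset.mem_univ, true_and, not_or, not_exists, ne_eq,
      not_not] at hv
    exact ⟨hv.1, hv.2.1, hv.2.2⟩
  -- the scale `L = k₀ + 2` and the counting hypothesis of the finite form
  obtain ⟨L, hL⟩ : ∃ L, L = k₀ + 2 := ⟨_, rfl⟩
  have h2L : 2 * n ≤ 2 ^ L := by
    have h := Nat.lt_pow_succ_log_self (b := 2) (by norm_num) n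
    rw [← hk₀] at h
    have h' : 2 * n ≤ 2 * 2 ^ (k₀ + 1) := Nat.mul_le_mul_left 2 h.le
    calc 2 * n ≤ 2 * 2 ^ (k₀ + 1) := h'
      _ = 2 ^ L := by rw [hL]; ring
  have hcnt1 : 2 * ((2 * L + 2) * F.card) ≤ n := by
    have h1 : 3 * (2 * (2 * L + 2)) ≤ s := by rw [hL]; omega
    have h2 : 3 * (2 * ((2 * L + 2) * F.card)) ≤ 3 * n := by
      calc 3 * (2 * ((2 * L + 2) * F.card)) = (3 * (2 * (2 * L + 2))) * F.card := by ring
        _ ≤ s * F.card := Nat.mul_le_mul_right _ h1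
        _ = F.card * s := by ring
        _ ≤ 3 * n := hFs
    exact Nat.le_of_mul_le_mul_left h2 (by norm_num)
  have hcount : n * (n - 1) + 2 ^ L * ((2 * L + 2) * F.card) < 2 ^ L * n := by
    have hA : 2 * (2 ^ L * ((2 * L + 2) * F.card)) ≤ 2 ^ L * n := by
      calc 2 * (2 ^ L * ((2 * L + 2) * F.card)) = 2 ^ L * (2 * ((2 * L + 2) * F.card)) := by ring
        _ ≤ 2 ^ L * n := Nat.mul_le_mul_left _ hcnt1
    have h3 : n * (n - 1) < n * n := by
      rw [Nat.mul_sub_one]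
      exact Nat.sub_lt (Nat.mul_pos hn1 hn1) hn1
    have hB : 2 * (n * n) ≤ 2 ^ L * n := by
      calc 2 * (n * n) = (2 * n) * n := by ring
        _ ≤ 2 ^ L * n := Nat.mul_le_mul_right _ h2L
    omega
  -- apply the finite form and convert the length bound
  obtain ⟨k, p, q, col, h1, h2, h3, h4, h5, _, hkL⟩ :=
    nearSymmetry_cleanWalk n L μ (fun c => (hμ c).1) (fun c => (hμ c).2) θ hθ2 hθf R F hF hcount
  refine ⟨k, p, q, col, h1, h2, h3, h4, h5, ?_⟩
  have hks : k + 1 ≤ s := by rw [hL] at hkL; omega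
  calc ((k : ℝ) + 1) = ((k + 1 : ℕ) : ℝ) := by push_cast; ring
    _ ≤ (s : ℝ) := by exact_mod_cast hks
    _ ≤ (n : ℝ) ^ ((1 : ℝ) / 4) := hsR

/-! ## Registered forms (`stub-add`ed on the crux item; signatures verbatim) -/

/-- **Registered form `stub_nearSymmetryWalk`** (crux `stmt-MatrixMultiplication-10883`, helper stub of siege seat k25):
`nearSymmetry_cleanWalk` verbatim. [folklore] -/
theorem stub_nearSymmetryWalk : ∀ (n L : ℕ) (μ : Fin 3 → Equiv.Perm (Fin n)), (∀ c, μ c * μ c = 1) → (∀ c v, μ c v ≠ v) → ∀ (θ : Equiv.Perm (Fin n)), (∀ v, θ (θ v) = v) → (∀ v, θ v ≠ v) → ∀ (R F : Finset (Fin n)), (∀ v, v ∉ F → v ∉ R ∧ θ v ∉ R ∧ ∀ c, θ (μ c v) = μ c (θ v)) → n * (n - 1) + 2 ^ L * ((2 * L + 2) * F.card) < 2 ^ L * n → ∃ (k : ℕ) (p q : Fin (k + 1) → Fin n) (col : Fin (k + 1) → Fin 3), (∀ i, p i ≠ q i) ∧ (∀ i, (μ (col i) (p i) = p (i + 1) ∧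 μ (col i) (q i) = q (i + 1)) ∨ (μ (col i) (p i) = q (i + 1) ∧ μ (col i) (q i) = p (i + 1))) ∧ (∀ i, col i ≠ col (i + 1)) ∧ (∀ i j, (p i = p j ∧ q i = q j) ∨ (p i = q j ∧ q i = p j) ∨ (p i ≠ p j ∧ p i ≠ q j ∧ q i ≠ p j ∧ q i ≠ q j)) ∧ (∀ i, p i ∉ R ∧ q i ∉ R) ∧ 2 ≤ k + 1 ∧ k + 1 ≤ 4 * L + 2 :=
  nearSymmetry_cleanWalk

/-- **Registered form `stub_nearSymmetryCore`** (crux `stmt-MatrixMultiplication-10883`, helper stub of siege seat k25):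
`nearSymmetry_core` verbatim — the quantifier shape of the open core `stub_poorRigidCore` with its poorness/rigidity
hypotheses replaced by an involutive near-symmetry. [folklore] -/
theorem stub_nearSymmetryCore : ∃ n₀ : ℕ, ∀ n ≥ n₀, ∀ μ : Fin 3 → Equiv.Perm (Fin n), (∀ i, μ i * μ i = 1 ∧ ∀ v, μ i v ≠ v) → ∀ θ : Equiv.Perm (Fin n), (∀ v, θ (θ v) = v) → (∀ v, θ v ≠ v) → (((Finset.univ : Finset (Fin n)).filter (fun v => ∃ i, θ (μ i v) ≠ μ i (θ v))).card : ℝ) ≤ (n : ℝ) ^ ((3 : ℝ) / 4) → ∀ R : Finset (Fin n), (R.card : ℝ) ≤ (n : ℝ) ^ ((3 : ℝ) / 4) → ∃ (k : ℕ) (p q : Fin (k + 1) → Fin n) (col : Fin (k + 1) → Fin 3), (∀ i, p i ≠ q i) ∧ (∀ i, (μ (col i) (p i) = p (i + 1) ∧ μ (col i) (q i) = q (i + 1)) ∨ (μ (col i) (p i) = q (i + 1) ∧ μ (col i) (q i) = p (i + 1))) ∧ (∀ i, col i ≠ col (i + 1)) ∧ (∀ i j, (p i = p j ∧ q i = q j)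 ∨ (p i = q j ∧ q i = p j) ∨ (p i ≠ p j ∧ p i ≠ q j ∧ q i ≠ p j ∧ q i ≠ q j)) ∧ (∀ i, p i ∉ R ∧ q i ∉ R) ∧ ((k : ℝ) + 1) ≤ (n : ℝ) ^ ((1 : ℝ) / 4) :=
  nearSymmetry_core

end Summit.MatrixMultiplication.MatrixMultiplication.Theorems.HyperoctahedralThreshold
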